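import Summits.FinalStateConjecture.FinalStateConjecture.Theorems.EIHFluxBalanceInertialRecessionRechartMesh
import Summits.FinalStateConjecture.FinalStateConjecture.Theorems.EIHFluxBalanceInertialRecessionHolePackage

/-!
# Route EIHFluxBalance — `InertialRecession`, re-charting: slowly growing profiles

Helper file for the crux `stmt-FinalStateConjecture-10166`
(`Summit.FinalStateConjecture.FinalStateConjecture.Theses.EIHFluxBalance.InertialRecession`),
line `sublinear-is-free-clean-window-charges`, stub `stub_rechart` (the transfer P2), part G1.

`exists_slow_profile` — if an admissibility predicate `P s r` ("clamp radius `r` is admissible at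
model time `s`") is antitone in `r` and, for every fixed natural radius `n`, holds for all late `s`,
then there is a SMOOTH profile `ρ ≥ 1`, `ρ → ∞`, admissible at all late times: `P s (ρ s)`
eventually. (Thresholds made monotone, the step function `Nat.findGreatest`, a monotone and then a
continuous minorant (`…RechartMesh`), and a smooth function between two continuous ones
(`exists_contDiff_between`, `…HolePackage`).) The clamp radius of the clock chart must grow slowly
against the (unknown) decay rate of the frame data; this lemma produces it. [folklore]
-/

noncomputable section

set_option linter.dupNamespace false

open Set Filter Topology

namespace Summit.FinalStateConjecture.FinalStateConjecture.Theorems.SublinearIsFree.Rechart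

/-- **Admissible step function.** Under the hypotheses of `exists_slow_profile` there is a function
`Ns ≥ 0`, `Ns → ∞`, with `P s (Ns s)` for all late `s`. [folklore] -/
theorem exists_admissible_step {P : ℝ → ℝ → Prop} (hev : ∀ n : ℕ, ∀ᶠ s in atTop, P s n) :
    ∃ Ns : ℝ → ℝ, (∀ s, 0 ≤ Ns s) ∧ Tendsto Ns atTop atTop ∧ ∀ᶠ s in atTop, P s (Ns s) := by
  classical
  have hT : ∀ n : ℕ, ∃ T : ℝ, ∀ s, T ≤ s → P s n := fun n ↦ eventually_atTop.1 (hev n)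
  choose T hT using hT
  set S : ℕ → ℝ := fun n ↦ max ((Finset.range (n + 1)).sup' ⟨0, by simp⟩ T) (n : ℝ) with hS
  have hST : ∀ n, T n ≤ S n := fun n ↦
    (Finset.le_sup' T (Finset.mem_range.2 (Nat.lt_succ_self n))).trans (le_max_left _ _)
  have hSn : ∀ n : ℕ, (n : ℝ) ≤ S n := fun n ↦ le_max_right _ _
  set Ns : ℝ → ℝ := fun s ↦ (Nat.findGreatest (fun n ↦ S n ≤ s) ⌈s⌉₊ : ℝ) with hNs
  have hge : ∀ (n : ℕ) (s : ℝ), S n ≤ s → (n : ℝ) ≤ Ns s := by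
    intro n s hs
    have hn : n ≤ ⌈s⌉₊ := by
      have : (n : ℝ) ≤ s := (hSn n).trans hs
      exact_mod_cast this.trans (Nat.le_ceil s)
    have h := Nat.le_findGreatest (P := fun n ↦ S n ≤ s) hn hs
    show (n : ℝ) ≤ (Nat.findGreatest (fun n ↦ S n ≤ s) ⌈s⌉₊ : ℝ)
    exact_mod_cast h
  refine ⟨Ns, fun s ↦ Nat.cast_nonneg _, ?_, ?_⟩
  · refine tendsto_atTop.2 fun b ↦ eventually_atTop.2 ⟨S ⌈b⌉₊, fun s hs ↦ ?_⟩
    exact (Nat.le_ceil b).trans (hge _ s hs)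
  · refine eventually_atTop.2 ⟨S 0, fun s hs ↦ ?_⟩
    set n : ℕ := Nat.findGreatest (fun n ↦ S n ≤ s) ⌈s⌉₊ with hn
    have hspec : S n ≤ s := Nat.findGreatest_spec (P := fun n ↦ S n ≤ s) (Nat.zero_le _) hs
    exact hT n s ((hST n).trans hspec)

/-- **Slowly growing smooth profile.** If `P s r` is antitone in `r` and holds, for every natural
`n`, at all late `s`, then there is a smooth `ρ ≥ 1` with `ρ → ∞` and `P s (ρ s)` at all late `s`.
[folklore] -/
theorem exists_slow_profile {P : ℝ → ℝ → Prop} (hanti : ∀ s r r', r' ≤ r → P s r → P s r')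
    (hev : ∀ n : ℕ, ∀ᶠ s in atTop, P s n) :
    ∃ ρ : ℝ → ℝ, ContDiff ℝ ((⊤ : ℕ∞) : WithTop ℕ∞) ρ ∧ (∀ s, 1 ≤ ρ s) ∧ Tendsto ρ atTop atTop ∧
      ∀ᶠ s in atTop, P s (ρ s) := by
  obtain ⟨Ns, hNs0, hNst, hNsP⟩ := exists_admissible_step hev
  obtain ⟨Nm, hNmm, hNmt, hNmle⟩ := exists_monotone_minorant hNs0 hNst
  obtain ⟨g, hgc, hgt, hgle⟩ := exists_continuous_minorant hNmm hNmt
  -- a smooth function between `max g 2 − 1` and `max g 2`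
  set u : ℝ → ℝ := fun s ↦ max (g s) 2 with hu
  have huc : Continuous u := hgc.max continuous_const
  obtain ⟨ρ, hρc, hρ⟩ := exists_contDiff_between (l := fun s ↦ u s - 1) (u := u)
    (huc.sub continuous_const) huc (fun s ↦ by linarith)
  refine ⟨ρ, hρc, fun s ↦ ?_, ?_, ?_⟩
  · have h1 := (hρ s).1
    have h2 : 2 ≤ u s := le_max_right _ _
    linarith
  · refine tendsto_atTop_mono (fun s ↦ (hρ s).1.le) ?_
    have h1 : Tendsto u atTop atTop := tendsto_atTop_mono (fun s ↦ le_max_left _ _) hgt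
    exact tendsto_atTop_add_const_right _ _ h1
  · have hg2 : ∀ᶠ s in atTop, 2 ≤ g s := hgt.eventually (eventually_ge_atTop 2)
    filter_upwards [hNsP, hg2] with s hP h2
    have hu' : u s = g s := max_eq_left h2
    refine hanti s (Ns s) (ρ s) ?_ hP
    calc ρ s ≤ u s := (hρ s).2.le
      _ = g s := hu'
      _ ≤ Nm s := hgle s
      _ ≤ Ns s := hNmle s

/-- Registered one-line form (worker carrier `rechart_exists_slow_profile`). [folklore] -/
theorem rechart_exists_slow_profile : open Filter in ∀ {P : ℝ → ℝ → Prop}, (∀ s r r', r' ≤ r → P s r → P s r') → (∀ n : ℕ, ∀ᶠ s in atTop, P s n) → ∃ ρ : ℝ → ℝ, ContDiff ℝ ((⊤ : ℕ∞) : WithTop ℕ∞) ρ ∧ (∀ s, 1 ≤ ρ s) ∧ Tendsto ρ atTop atTop ∧ ∀ᶠ s in atTop, P s (ρ s) :=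
  fun hanti hev ↦ exists_slow_profile hanti hev

end Summit.FinalStateConjecture.FinalStateConjecture.Theorems.SublinearIsFree.Rechart

end
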